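import Literature.MathematicalPhysics.QuantumFieldTheory.TorusChartGreen
import HarnessLib

/-!
# The Hodge decomposition of `1`-cochains on a finite charted torus; the Coulomb (Biot–Savart) representative

On a finite charted torus every real `1`-cochain (bond field) splits `ℓ²`-orthogonally as
`ω = d₀ (G δ₁ ω) + δ₂ (G d₁ ω) + harm₁ ω` — gradient (spin-wave) part, **coexact part** `coexact (d₁ ω) := δ₂ G (d₁ ω)`
determined by the plaquette circulations (vortex current) `d₁ ω` alone, and the constant (harmonic, winding) part
`harm₁ ω` (componentwise means).  This is the Hodge decomposition of Eckmann for the cubic torus, where the Hodge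
Laplacian is the scalar lattice Laplacian componentwise (`TorusChartHodge.d₀_δ₁_add_δ₂_d₁`) and `G` is its Green's
operator (`TorusChartGreen.lean`); in the Villain / Fröhlich–Spencer unfolding of an abelian model it is the exact
spin-wave / vortex factorisation: `coexact (d₁ a)` is the Coulomb-gauge (Biot–Savart) strain field of the vortex current
`d₁ a`, and its energy is the Coulomb energy of the current.

* `hodge_decomposition : ω = d₀ (G (δ₁ ω)) + coexact (d₁ ω) + harm₁ ω`;
* `coexact q = δ₂ (G q)`: coclosed (`δ₁_coexact`), componentwise mean zero (`sum_coexact`), `d₁ (coexact (d₁ ω)) = d₁ ω`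
  (`d₁_coexact_d₁`), gauge invariant (`coexact_d₁_add_d₀`), and UNIQUE with these properties (`eq_coexact_d₁`: a coclosed,
  componentwise-mean-zero cochain with the same circulations as `ω` is `coexact (d₁ ω)`);
* **energy**: `sum_sq_coexact_d₁ : ‖coexact (d₁ ω)‖² = ½ Σ_{x,i,j} d₁ω · G d₁ω` (the Coulomb energy of the current; ordered
  pairs), orthogonality of the three parts (`sum_d₀_mul_coexact`, `sum_d₀_mul_harm₁`, `sum_coexact_mul_harm₁`), Pythagoras
  (`sum_sq_eq_three_parts`) and **minimality** (`sum_sq_coexact_add_harm₁_le`: `‖coexact (d₁ ω) + harm₁ ω‖² ≤ ‖ω − d₀ f‖²`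
  for every `f` — the Coulomb representative minimises the `ℓ²` norm in the class `ω + d₀(·)`), `sum_sq_coexact_le`.

## References
* B. Eckmann, Comment. Math. Helv. 17 (1945) 240–255.
* J. Fröhlich, T. Spencer, The Kosterlitz–Thouless transition in two-dimensional abelian spin systems and the Coulomb
  gas, Comm. Math. Phys. 81 (1981) 527–602, §3 (spin waves and vortices). [FrohlichSpencer1981]
* J. Fröhlich, T. Spencer, Comm. Math. Phys. 83 (1982) 411–454, §2.3–2.5. [FrohlichSpencerCMP1982]
-/

noncomputable section

namespace Literature.MathematicalPhysics.QuantumFieldTheory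

open scoped BigOperators

namespace TorusChart

variable {Λ : Type*} [AddCommGroup Λ] {d : ℕ} (F : TorusChart Λ d) [Fintype Λ]

/-! ## The coexact (Coulomb) part and the decomposition -/

/-- **The coexact (Coulomb, Biot–Savart) `1`-cochain of a `2`-cochain** `q`: `coexact q = δ₂ (G q)`.  For `q = d₁ ω` this is
the part of `ω` determined by its plaquette circulations. [folklore] -/
def coexact (q : Λ → Fin d → Fin d → ℝ) : Λ → Fin d → ℝ := F.δ₂ (F.green₂ q)

/-- Unfolding `coexact`. [folklore] -/
theorem coexact_def (q : Λ → Fin d → Fin d → ℝ) : F.coexact q = F.δ₂ (F.green₂ q) := rfl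

/-- **Hodge decomposition** of a real `1`-cochain on the finite torus:
`ω = d₀ (G (δ₁ ω)) + coexact (d₁ ω) + harm₁ ω`. [folklore] -/
theorem hodge_decomposition (ω : Λ → Fin d → ℝ) :
    ω = F.d₀ (F.green (F.δ₁ ω)) + F.coexact (F.d₁ ω) + harm₁ ω := by
  have h := F.d₀_δ₁_add_δ₂_d₁ (F.green₁ ω)
  rw [δ₁_green₁, d₁_green₁, negLap₁_green₁] at h
  rw [coexact_def, h, sub_add_cancel]

/-- The decomposition solved for the non-gradient part: `ω − d₀ (G δ₁ ω) = coexact (d₁ ω) + harm₁ ω`. [folklore] -/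
theorem sub_d₀_green_δ₁ (ω : Λ → Fin d → ℝ) :
    ω - F.d₀ (F.green (F.δ₁ ω)) = F.coexact (F.d₁ ω) + harm₁ ω := by
  nth_rewrite 1 [F.hodge_decomposition ω]
  abel

/-- `coexact` is additive. [folklore] -/
theorem coexact_add (q p : Λ → Fin d → Fin d → ℝ) : F.coexact (q + p) = F.coexact q + F.coexact p := by
  rw [coexact_def, green₂_add, δ₂_add]; rfl

/-- `coexact` is homogeneous. [folklore] -/
theorem coexact_smul (c : ℝ) (q : Λ → Fin d → Fin d → ℝ) : F.coexact (c • q) = c • F.coexact q := by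
  rw [coexact_def, coexact_def, green₂_smul]
  funext x i
  simp only [δ₂_apply, Pi.smul_apply, smul_eq_mul, Finset.mul_sum, mul_sub]

/-- `coexact 0 = 0`. [folklore] -/
@[simp] theorem coexact_zero : F.coexact (0 : Λ → Fin d → Fin d → ℝ) = 0 := by
  have h := F.coexact_smul 0 0
  rwa [zero_smul, zero_smul] at h

/-- `coexact q` has zero total in every direction. [folklore] -/
theorem sum_coexact (q : Λ → Fin d → Fin d → ℝ) (i : Fin d) : ∑ x, F.coexact q x i = 0 := by
  rw [coexact_def]; exact F.sum_δ₂ _ i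

/-- `coexact q` has zero mean in every direction. [folklore] -/
theorem harm₁_coexact (q : Λ → Fin d → Fin d → ℝ) : harm₁ (F.coexact q) = 0 := by
  funext x i
  rw [harm₁_apply, mean_eq_zero_of_sum_eq_zero (F.sum_coexact q i)]; rfl

/-- **`coexact q` is coclosed** for alternating `q`. [folklore] -/
theorem δ₁_coexact {q : Λ → Fin d → Fin d → ℝ} (h0 : ∀ x i, q x i i = 0) (hs : ∀ x i j, q x j i = -q x i j) :
    F.δ₁ (F.coexact q) = 0 := by
  rw [coexact_def]
  exact F.δ₁_δ₂_of_alternating _ (fun x i => F.green₂_self h0 x i) fun x i j => F.green₂_swap hs x i j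

/-- `coexact (d₁ ω)` is coclosed. [folklore] -/
theorem δ₁_coexact_d₁ (ω : Λ → Fin d → ℝ) : F.δ₁ (F.coexact (F.d₁ ω)) = 0 :=
  F.δ₁_coexact (fun x i => F.d₁_self ω x i) fun x i j => F.d₁_swap ω x i j

/-- **`coexact (d₁ ω)` has the circulations of `ω`**: `d₁ (coexact (d₁ ω)) = d₁ ω`. [folklore] -/
theorem d₁_coexact_d₁ (ω : Λ → Fin d → ℝ) : F.d₁ (F.coexact (F.d₁ ω)) = F.d₁ ω := by
  have h := congrArg F.d₁ (F.hodge_decomposition ω)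
  rw [d₁_add, d₁_add, d₁_d₀, zero_add] at h
  have hh : F.d₁ (harm₁ ω) = 0 := F.d₁_const _
  rw [hh, add_zero] at h
  exact h.symm

/-- **Gauge invariance**: `coexact (d₁ (ω + d₀ f)) = coexact (d₁ ω)`. [folklore] -/
theorem coexact_d₁_add_d₀ (ω : Λ → Fin d → ℝ) (f : Λ → ℝ) :
    F.coexact (F.d₁ (ω + F.d₀ f)) = F.coexact (F.d₁ ω) := by
  rw [d₁_add, d₁_d₀, add_zero]

/-- The coexact part of a gradient vanishes. [folklore] -/
theorem coexact_d₁_d₀ (f : Λ → ℝ) : F.coexact (F.d₁ (F.d₀ f)) = 0 := by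
  rw [d₁_d₀, coexact_zero]

/-- **Uniqueness of the Coulomb representative**: a coclosed `1`-cochain with zero total in every direction and the
same circulations as `ω` is `coexact (d₁ ω)`. [folklore] -/
theorem eq_coexact_d₁ {ω η : Λ → Fin d → ℝ} (hd : F.d₁ η = F.d₁ ω) (hδ : F.δ₁ η = 0)
    (hsum : ∀ i, ∑ x, η x i = 0) : η = F.coexact (F.d₁ ω) := by
  set ζ := η - F.coexact (F.d₁ ω) with hζ
  have hd' : F.d₁ ζ = 0 := by rw [hζ, d₁_sub, hd, d₁_coexact_d₁, sub_self]
  have hδ' : F.δ₁ ζ = 0 := by rw [hζ, δ₁_sub, hδ, δ₁_coexact_d₁, sub_self]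
  have hlap : F.negLap₁ ζ = 0 := by
    rw [← d₀_δ₁_add_δ₂_d₁, hd', hδ', d₀_zero, δ₂_zero, add_zero]
  have hconst := (F.negLap₁_eq_zero_iff ζ).1 hlap
  have hzero : ∀ i, ζ 0 i = 0 := fun i => by
    have hs : ∑ x, ζ x i = 0 := by
      simp only [hζ, Pi.sub_apply, Finset.sum_sub_distrib, hsum i, sum_coexact, sub_self]
    have : ∑ x, ζ x i = Fintype.card Λ • ζ 0 i := by
      rw [← Finset.card_univ, ← Finset.sum_const]
      exact Finset.sum_congr rfl fun x _ => hconst x i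
    rw [this, nsmul_eq_mul] at hs
    rcases mul_eq_zero.1 hs with h | h
    · exact absurd h (Nat.cast_ne_zero.2 Fintype.card_ne_zero)
    · exact h
  have hζ0 : ζ = 0 := by
    funext x i; rw [hconst x i, hzero i]; rfl
  rw [hζ] at hζ0
  exact sub_eq_zero.1 hζ0

/-! ## Energies: orthogonality, the Coulomb energy, minimality -/

/-- The gradient part is orthogonal to coclosed cochains, in particular to `coexact q` (alternating `q`). [folklore] -/
theorem sum_d₀_mul_coexact (f : Λ → ℝ) {q : Λ → Fin d → Fin d → ℝ} (h0 : ∀ x i, q x i i = 0)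
    (hs : ∀ x i j, q x j i = -q x i j) : ∑ x, ∑ i, F.d₀ f x i * F.coexact q x i = 0 := by
  rw [sum_d₀_mul, F.δ₁_coexact h0 hs]
  simp

/-- The gradient part is orthogonal to the harmonic part. [folklore] -/
theorem sum_d₀_mul_harm₁ (f : Λ → ℝ) (ω : Λ → Fin d → ℝ) : ∑ x, ∑ i, F.d₀ f x i * harm₁ ω x i = 0 := by
  rw [Finset.sum_comm]
  refine Finset.sum_eq_zero fun i _ => ?_
  simp only [harm₁_apply, ← Finset.sum_mul, F.sum_d₀ f i, zero_mul]

/-- The coexact part is orthogonal to the harmonic part. [folklore] -/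
theorem sum_coexact_mul_harm₁ (q : Λ → Fin d → Fin d → ℝ) (ω : Λ → Fin d → ℝ) :
    ∑ x, ∑ i, F.coexact q x i * harm₁ ω x i = 0 := by
  rw [Finset.sum_comm]
  refine Finset.sum_eq_zero fun i _ => ?_
  simp only [harm₁_apply, ← Finset.sum_mul, F.sum_coexact q i, zero_mul]

/-- **The energy of the Coulomb representative is the Coulomb energy of the current**:
`Σ_{x,i} (coexact (d₁ ω) (x,i))² = ½ Σ_{x,i,j} d₁ ω (x;i,j) · G (d₁ ω) (x;i,j)` (ordered pairs). [folklore] -/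
theorem sum_sq_coexact_d₁ (ω : Λ → Fin d → ℝ) :
    ∑ x, ∑ i, (F.coexact (F.d₁ ω) x i) ^ 2
      = (1 / 2 : ℝ) * ∑ x, ∑ i, ∑ j, F.d₁ ω x i j * F.green₂ (F.d₁ ω) x i j := by
  have halt : ∀ x i j, F.green₂ (F.d₁ ω) x j i = -F.green₂ (F.d₁ ω) x i j :=
    fun x i j => F.green₂_swap (fun y i j => F.d₁_swap ω y i j) x i j
  have h := F.sum_d₁_mul_of_alternating (F.coexact (F.d₁ ω)) (F.green₂ (F.d₁ ω)) halt
  rw [d₁_coexact_d₁] at h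
  rw [h]
  simp only [coexact_def, pow_two]
  ring

/-- The Coulomb energy of a `2`-cochain is nonnegative: `Σ q · G q ≥ 0` (componentwise positivity of `G`). [folklore] -/
theorem sum_mul_green₂_self_nonneg (q : Λ → Fin d → Fin d → ℝ) :
    0 ≤ ∑ x, ∑ i, ∑ j, q x i j * F.green₂ q x i j := by
  have hsw : ∑ x, ∑ i, ∑ j, q x i j * F.green₂ q x i j = ∑ i, ∑ j, ∑ x, q x i j * F.green₂ q x i j := by
    rw [Finset.sum_comm]; exact Finset.sum_congr rfl fun i _ => Finset.sum_comm
  rw [hsw]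
  refine Finset.sum_nonneg fun i _ => Finset.sum_nonneg fun j _ => ?_
  simp only [green₂_apply]
  exact F.sum_mul_green_self_nonneg fun y => q y i j

/-- **Pythagoras for the Hodge decomposition**:
`‖ω‖² = ‖d₀ G δ₁ ω‖² + ‖coexact (d₁ ω)‖² + ‖harm₁ ω‖²`. [folklore] -/
theorem sum_sq_eq_three_parts (ω : Λ → Fin d → ℝ) :
    ∑ x, ∑ i, (ω x i) ^ 2
      = ∑ x, ∑ i, (F.d₀ (F.green (F.δ₁ ω)) x i) ^ 2 + ∑ x, ∑ i, (F.coexact (F.d₁ ω) x i) ^ 2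
        + ∑ x, ∑ i, (harm₁ ω x i) ^ 2 := by
  have h1 := F.sum_d₀_mul_coexact (F.green (F.δ₁ ω)) (fun x i => F.d₁_self ω x i) (fun x i j => F.d₁_swap ω x i j)
  have h2 := F.sum_d₀_mul_harm₁ (F.green (F.δ₁ ω)) ω
  have h3 := F.sum_coexact_mul_harm₁ (F.d₁ ω) ω
  have hexp : ∀ x i, (ω x i) ^ 2 = (F.d₀ (F.green (F.δ₁ ω)) x i) ^ 2 + (F.coexact (F.d₁ ω) x i) ^ 2
      + (harm₁ ω x i) ^ 2 + 2 * (F.d₀ (F.green (F.δ₁ ω)) x i * F.coexact (F.d₁ ω) x i)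
      + 2 * (F.d₀ (F.green (F.δ₁ ω)) x i * harm₁ ω x i) + 2 * (F.coexact (F.d₁ ω) x i * harm₁ ω x i) := by
    intro x i
    have hx := congr_fun (congr_fun (F.hodge_decomposition ω) x) i
    simp only [Pi.add_apply] at hx
    rw [hx]; ring
  simp only [hexp, Finset.sum_add_distrib, ← Finset.mul_sum, h1, h2, h3, mul_zero, add_zero]

/-- **Minimality of the Coulomb representative**: for every `0`-cochain `f`,
`‖coexact (d₁ ω) + harm₁ ω‖² ≤ ‖ω − d₀ f‖²` — among all representatives of the class `ω + d₀(·)` the one with no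
gradient part has the least `ℓ²` norm. [folklore] -/
theorem sum_sq_coexact_add_harm₁_le (ω : Λ → Fin d → ℝ) (f : Λ → ℝ) :
    ∑ x, ∑ i, (F.coexact (F.d₁ ω) x i + harm₁ ω x i) ^ 2 ≤ ∑ x, ∑ i, (ω x i - F.d₀ f x i) ^ 2 := by
  -- `ω − d₀ f = d₀ (G δ₁ ω − f) + (coexact + harm)` with the two summands orthogonal
  set g := F.green (F.δ₁ ω) - f with hg
  have hdec : ∀ x i, ω x i - F.d₀ f x i = F.d₀ g x i + (F.coexact (F.d₁ ω) x i + harm₁ ω x i) := by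
    intro x i
    have hx := congr_fun (congr_fun (F.hodge_decomposition ω) x) i
    simp only [Pi.add_apply] at hx
    rw [hg, d₀_sub, Pi.sub_apply, Pi.sub_apply]
    conv_lhs => rw [hx]
    ring
  have horth : ∑ x, ∑ i, F.d₀ g x i * (F.coexact (F.d₁ ω) x i + harm₁ ω x i) = 0 := by
    simp only [mul_add, Finset.sum_add_distrib,
      F.sum_d₀_mul_coexact g (fun x i => F.d₁_self ω x i) (fun x i j => F.d₁_swap ω x i j),
      F.sum_d₀_mul_harm₁ g ω, add_zero]
  have hexp : ∑ x, ∑ i, (ω x i - F.d₀ f x i) ^ 2 = ∑ x, ∑ i, (F.d₀ g x i) ^ 2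
      + ∑ x, ∑ i, (F.coexact (F.d₁ ω) x i + harm₁ ω x i) ^ 2 := by
    have : ∀ x i, (ω x i - F.d₀ f x i) ^ 2 = (F.d₀ g x i) ^ 2 + (F.coexact (F.d₁ ω) x i + harm₁ ω x i) ^ 2
        + 2 * (F.d₀ g x i * (F.coexact (F.d₁ ω) x i + harm₁ ω x i)) := fun x i => by rw [hdec]; ring
    simp only [this, Finset.sum_add_distrib, ← Finset.mul_sum, horth, mul_zero, add_zero]
  rw [hexp]
  have : 0 ≤ ∑ x, ∑ i, (F.d₀ g x i) ^ 2 := Finset.sum_nonneg fun x _ => Finset.sum_nonneg fun i _ => sq_nonneg _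
  linarith

/-- The squared norm of the Coulomb representative splits: `‖coexact (d₁ ω) + harm₁ ω‖² = ‖coexact (d₁ ω)‖² + ‖harm₁ ω‖²`.
[folklore] -/
theorem sum_sq_coexact_add_harm₁ (ω : Λ → Fin d → ℝ) :
    ∑ x, ∑ i, (F.coexact (F.d₁ ω) x i + harm₁ ω x i) ^ 2
      = ∑ x, ∑ i, (F.coexact (F.d₁ ω) x i) ^ 2 + ∑ x, ∑ i, (harm₁ ω x i) ^ 2 := by
  have h3 := F.sum_coexact_mul_harm₁ (F.d₁ ω) ω
  have : ∀ x i, (F.coexact (F.d₁ ω) x i + harm₁ ω x i) ^ 2 = (F.coexact (F.d₁ ω) x i) ^ 2 + (harm₁ ω x i) ^ 2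
      + 2 * (F.coexact (F.d₁ ω) x i * harm₁ ω x i) := fun x i => by ring
  simp only [this, Finset.sum_add_distrib, ← Finset.mul_sum, h3, mul_zero, add_zero]

/-- The coexact part is norm-decreasing: `‖coexact (d₁ ω)‖² ≤ ‖ω‖²`. [folklore] -/
theorem sum_sq_coexact_le (ω : Λ → Fin d → ℝ) :
    ∑ x, ∑ i, (F.coexact (F.d₁ ω) x i) ^ 2 ≤ ∑ x, ∑ i, (ω x i) ^ 2 := by
  rw [F.sum_sq_eq_three_parts ω]
  have h1 : 0 ≤ ∑ x, ∑ i, (F.d₀ (F.green (F.δ₁ ω)) x i) ^ 2 :=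
    Finset.sum_nonneg fun x _ => Finset.sum_nonneg fun i _ => sq_nonneg _
  have h3 : 0 ≤ ∑ x, ∑ i, (harm₁ ω x i) ^ 2 := Finset.sum_nonneg fun x _ => Finset.sum_nonneg fun i _ => sq_nonneg _
  linarith

/-- The Coulomb energy of the current is bounded by the energy of any cochain carrying it:
`½ Σ d₁ω · G d₁ω ≤ ‖ω‖²`. [folklore] -/
theorem half_sum_d₁_mul_green₂_le (ω : Λ → Fin d → ℝ) :
    (1 / 2 : ℝ) * ∑ x, ∑ i, ∑ j, F.d₁ ω x i j * F.green₂ (F.d₁ ω) x i j ≤ ∑ x, ∑ i, (ω x i) ^ 2 := by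
  rw [← sum_sq_coexact_d₁]; exact F.sum_sq_coexact_le ω

end TorusChart

end Literature.MathematicalPhysics.QuantumFieldTheory

end
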